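import Literature.Analysis.FluidPDE.Seregin2019ScaleInvariantBounds
import Literature.Analysis.FluidPDE.LocalEnergySliceLEI
import HarnessLib

/-!
# Seregin 2019, §4: the pairings of the sparse top slice with test fields are small

Analysis/FluidPDE proofs-only file (theorems only: no definitions, no named facts, no `sorry`),
a tranche of the input `Literature.Analysis.FluidPDE.seregin2019_localWeakL3_epsRegularity`
(`Seregin2019LocalWeakL3.lean`; G. Seregin, arXiv:1906.06707 = St. Petersburg Math. J. 32 (2021)
565–576, Prop. 1.3/1.4). No Navier–Stokes regularity statement is proved here.

In the proof of Prop. 1.3 (§4, p. 8) the vanishing of the blow-up limit at the final time,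
`u(x, 0) = 0` on `B`, "follows from the known inequality
`|{y ∈ B : |u(y,0)| > α}| ≤ |{y ∈ B : |u^k(y,0)| > α/2}| + |{y ∈ B : |u^k(y,0) − u(y,0)| > α/2}|`",
i.e. from the smallness of the rescaled top slices `|{y ∈ B : |u^k(y,0)| > ε_k}| ≤ ε_k` together
with their weak-`L³` bound. In the tree the top slice `u(t₀)` of the transcription
`seregin2019_localWeakL3_epsRegularity` is an arbitrary function tied to the solution only by
**weak left-continuity in `L²(B(x₀,R))`** (the printed representative, see the module docstring of
`Seregin2019LocalWeakL3.lean`), so the usable form of that smallness is a bound on the PAIRINGS of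
the top slice with bounded fields supported in the sparse ball, proved here without any
measurability or integrability assumption on `u(t₀)` itself:

* `Seregin2019.abs_integral_inner_top_le` — if the slices `u(t)`, `t ∈ ]t₁, t₀[`, are weak-`L³`
  on `B(x₀,R)` with `sup_s s³ |{|u(t)| > s} ∩ B(x₀,R)| ≤ W`, `u(t₀)` is their weak left limit in
  `L²(B(x₀,R))`, and `|{x ∈ B(x₀,ϱ) : τ < |u(t₀,x)|}| ≤ m` (`B(x₀,ϱ) ⊆ B(x₀,R)`), then for every
  bounded a.e.-strongly measurable field `θ`, `|θ| ≤ Θ₀`, supported in `B(x₀,ϱ)`, and every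
  `λ > 0`: `|∫ ⟪u(t₀), θ⟫| ≤ Θ₀ (m λ + ½ λ⁻² W) + τ ∫ |θ|`.

Proof: split `θ = θ 𝟙_E + θ 𝟙_{Eᶜ}` with `E ⊇ {τ < |u(t₀)|} ∩ B(x₀,ϱ)` measurable of measure
`≤ m`; the pairing with `θ 𝟙_E` is the limit of `∫_E ⟪u(t), θ⟫`, bounded through
`L^{3,∞} ⊂ L¹_loc` quantitatively (`MemWeakLp.setLIntegral_rpow_le`: `∫_E |u(t)| ≤ |E| λ + ½ λ⁻² W`);
the pairing with `θ 𝟙_{Eᶜ}` is bounded pointwise by `τ |θ|` (and is `0` if not integrable).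

## References

* G. Seregin, arXiv:1906.06707 (2019), §4 p. 8 ("The latter identity follows from the known
  inequality …"); §1 p. 2 (the representative at the top time). [`Seregin2019`]
* Z. Bradshaw, T.-P. Tsai, Ann. Henri Poincaré 18 (2017), §1 (`L³_w ⊂ L²_uloc`). [`BradshawTsai2017AHP`]
-/

noncomputable section

open MeasureTheory Set Function Filter Topology TopologicalSpace Metric
open scoped NNReal ENNReal InnerProductSpace RealInnerProductSpace

namespace Literature.Analysis.FluidPDE

namespace Seregin2019

open Literature.Analysis.FunctionSpaces

/-- A bounded a.e.-strongly measurable field supported in a ball is square integrable. [folklore] -/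
private theorem memLp_two_of_bound_of_support
    {θ : EuclideanSpace ℝ (Fin 3) → EuclideanSpace ℝ (Fin 3)} (hθm : AEStronglyMeasurable θ volume)
    {C : ℝ} (hθb : ∀ x, ‖θ x‖ ≤ C) {x₀ : EuclideanSpace ℝ (Fin 3)} {ρ : ℝ}
    (hθs : support θ ⊆ ball x₀ ρ) : MemLp θ 2 volume := by
  have hθ' : (ball x₀ ρ).indicator θ = θ := indicator_eq_self.2 hθs
  rw [← hθ', memLp_indicator_iff_restrict measurableSet_ball]
  haveI : IsFiniteMeasure (volume.restrict (ball x₀ ρ)) :=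
    isFiniteMeasure_restrict.2 measure_ball_lt_top.ne
  exact (memLp_top_of_bound hθm.restrict C (Eventually.of_forall hθb)).mono_exponent le_top

/-- A bounded a.e.-strongly measurable field supported in a ball is integrable. [folklore] -/
private theorem integrable_of_bound_of_support
    {θ : EuclideanSpace ℝ (Fin 3) → EuclideanSpace ℝ (Fin 3)} (hθm : AEStronglyMeasurable θ volume)
    {C : ℝ} (hθb : ∀ x, ‖θ x‖ ≤ C) {x₀ : EuclideanSpace ℝ (Fin 3)} {ρ : ℝ}
    (hθs : support θ ⊆ ball x₀ ρ) : Integrable θ volume := by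
  have hθ' : (ball x₀ ρ).indicator θ = θ := indicator_eq_self.2 hθs
  rw [← hθ', integrable_indicator_iff measurableSet_ball]
  haveI : IsFiniteMeasure (volume.restrict (ball x₀ ρ)) :=
    isFiniteMeasure_restrict.2 measure_ball_lt_top.ne
  exact (memLp_top_of_bound hθm.restrict C (Eventually.of_forall hθb)).mono_exponent le_top
    |>.integrable le_rfl

/-- **The pairings of a sparse top slice are small** (the usable content of "if
`r⁻³|{x ∈ B(x₀,r) : |v(x,t₀)| > ε/r}| ≤ ε`" for the representative `v(·,t₀)` = weak left limit
of the slices, Seregin 2019, §1 p. 2 and §4 p. 8). Let the slices `u(t)`, `t ∈ ]t₁,t₀[`, be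
a.e.-strongly measurable on `B(x₀,R)` for a.e. `t` and weak-`L³` there with
`sup_s s³ |{s < |u(t)|} ∩ B(x₀,R)| ≤ W < ∞` for every `t`; let `u(t₀)` be the weak left limit of
`u(t)` in `L²(B(x₀,R))` (pairings with square-integrable fields supported in the ball converge);
let `|{x ∈ B(x₀,ϱ) : τ < |u(t₀,x)|}| ≤ m` with `B(x₀,ϱ) ⊆ B(x₀,R)`, `0 ≤ τ`, `0 ≤ m`. Then for
every a.e.-strongly measurable field `θ` with `|θ| ≤ Θ₀`, supported in `B(x₀,ϱ)`, and every
`λ > 0`: `|∫ ⟪u(t₀), θ⟫| ≤ Θ₀ (m λ + ½ λ⁻² W) + τ ∫ |θ|`. No measurability of `u(t₀)` is assumed.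
[cite: Seregin2019, §4 p. 8 (smallness of the top slices passes to the limit) and §1 p. 2 (the representative at t₀)] -/
theorem abs_integral_inner_top_le
    {u : ℝ → EuclideanSpace ℝ (Fin 3) → EuclideanSpace ℝ (Fin 3)} {t₁ t₀ : ℝ} (ht : t₁ < t₀)
    {x₀ : EuclideanSpace ℝ (Fin 3)} {R : ℝ}
    (hum : ∀ᵐ t ∂(volume.restrict (Ioo t₁ t₀)),
      AEStronglyMeasurable (u t) (volume.restrict (ball x₀ R)))
    {W : ℝ≥0∞} (hW : W ≠ ∞)
    (hweak : ∀ t ∈ Ioo t₁ t₀, eWeakLpPow (u t) 3 (volume.restrict (ball x₀ R)) ≤ W)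
    (hcont : ∀ w : EuclideanSpace ℝ (Fin 3) → EuclideanSpace ℝ (Fin 3), MemLp w 2 volume →
      support w ⊆ ball x₀ R →
      Tendsto (fun t => ∫ x, ⟪u t x, w x⟫) (𝓝[<] t₀) (𝓝 (∫ x, ⟪u t₀ x, w x⟫)))
    {ϱ τ m : ℝ} (hϱR : ball x₀ ϱ ⊆ ball x₀ R) (hτ : 0 ≤ τ) (hm : 0 ≤ m)
    (hsparse : volume.restrict (ball x₀ ϱ) {x | τ < ‖u t₀ x‖} ≤ ENNReal.ofReal m)
    {θ : EuclideanSpace ℝ (Fin 3) → EuclideanSpace ℝ (Fin 3)} (hθm : AEStronglyMeasurable θ volume)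
    {Θ₀ : ℝ} (hθb : ∀ x, ‖θ x‖ ≤ Θ₀) (hθs : support θ ⊆ ball x₀ ϱ) {lam : ℝ} (hlam : 0 < lam) :
    |∫ x, ⟪u t₀ x, θ x⟫| ≤ Θ₀ * (m * lam + 1 / 2 * lam⁻¹ ^ 2 * W.toReal) + τ * ∫ x, ‖θ x‖ := by
  have hΘ₀ : 0 ≤ Θ₀ := (norm_nonneg _).trans (hθb x₀)
  -- ## the measurable hull `E` of the sparse set
  set E₀ : Set (EuclideanSpace ℝ (Fin 3)) := {x | τ < ‖u t₀ x‖} ∩ ball x₀ ϱ with hE₀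
  have hE₀m : volume E₀ ≤ ENNReal.ofReal m := by
    rw [hE₀, ← Measure.restrict_apply' measurableSet_ball]
    exact hsparse
  set E : Set (EuclideanSpace ℝ (Fin 3)) := toMeasurable volume E₀ ∩ ball x₀ ϱ with hE
  have hEm : MeasurableSet E := (measurableSet_toMeasurable _ _).inter measurableSet_ball
  have hE₀E : E₀ ⊆ E := fun x hx => ⟨subset_toMeasurable _ _ hx, hx.2⟩
  have hEball : E ⊆ ball x₀ ϱ := inter_subset_right
  have hEvol : volume E ≤ ENNReal.ofReal m :=
    (measure_mono inter_subset_left).trans ((measure_toMeasurable E₀).le.trans hE₀m)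
  -- ## the split `θ = θ_E + θ_c`
  set θE : EuclideanSpace ℝ (Fin 3) → EuclideanSpace ℝ (Fin 3) := E.indicator θ with hθE
  set θc : EuclideanSpace ℝ (Fin 3) → EuclideanSpace ℝ (Fin 3) := Eᶜ.indicator θ with hθc
  have hsplit : θ = θE + θc := by
    funext x; simp only [hθE, hθc, Pi.add_apply, indicator_self_add_compl_apply]
  have hθEm : AEStronglyMeasurable θE volume := hθm.indicator hEm
  have hθcm : AEStronglyMeasurable θc volume := hθm.indicator hEm.compl
  have hθEb : ∀ x, ‖θE x‖ ≤ Θ₀ := fun x => (norm_indicator_le_norm_self _ _).trans (hθb x)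
  have hθcb : ∀ x, ‖θc x‖ ≤ Θ₀ := fun x => (norm_indicator_le_norm_self _ _).trans (hθb x)
  have hθEs : support θE ⊆ ball x₀ ϱ := support_indicator_subset.trans hEball
  have hθcs : support θc ⊆ ball x₀ ϱ :=
    fun x hx => hθs (mt (fun h0 => indicator_apply_eq_zero.2 fun _ => h0) hx)
  have hθE2 : MemLp θE 2 volume := memLp_two_of_bound_of_support hθEm hθEb hθEs
  have hθc2 : MemLp θc 2 volume := memLp_two_of_bound_of_support hθcm hθcb hθcs
  have hθ2 : MemLp θ 2 volume := memLp_two_of_bound_of_support hθm hθb hθs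
  -- ## the three limits
  have hL := hcont θ hθ2 (hθs.trans hϱR)
  have hLE := hcont θE hθE2 (hθEs.trans hϱR)
  have hLc := hcont θc hθc2 (hθcs.trans hϱR)
  -- ## a sequence of good times increasing to `t₀`
  have hgood : ∀ᵐ t ∂(volume : Measure ℝ), t ∈ Ioo t₁ t₀ →
      AEStronglyMeasurable (u t) (volume.restrict (ball x₀ R)) :=
    (ae_restrict_iff' measurableSet_Ioo).1 hum
  have hseq : ∃ tn : ℕ → ℝ, (∀ n, tn n ∈ Ioo t₁ t₀ ∧ t₀ - 1 / ((n : ℝ) + 1) < tn n ∧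
      AEStronglyMeasurable (u (tn n)) (volume.restrict (ball x₀ R))) := by
    have h : ∀ n : ℕ, ∃ t, t ∈ Ioo t₁ t₀ ∧ t₀ - 1 / ((n : ℝ) + 1) < t ∧
        AEStronglyMeasurable (u t) (volume.restrict (ball x₀ R)) := by
      intro n
      have hpos : (0 : ℝ) < 1 / ((n : ℝ) + 1) := by positivity
      have hlt : max t₁ (t₀ - 1 / ((n : ℝ) + 1)) < t₀ := max_lt ht (by linarith)
      obtain ⟨t, htI, hP⟩ := exists_mem_Ioo_of_ae hgood hlt
      have ht' : t ∈ Ioo t₁ t₀ := ⟨(le_max_left _ _).trans_lt htI.1, htI.2⟩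
      exact ⟨t, ht', (le_max_right _ _).trans_lt htI.1, hP ht'⟩
    choose tn htn using h
    exact ⟨tn, htn⟩
  obtain ⟨tn, htn⟩ := hseq
  have htn_lim : Tendsto tn atTop (𝓝[<] t₀) := by
    refine tendsto_nhdsWithin_iff.2 ⟨?_, Eventually.of_forall fun n => (htn n).1.2⟩
    have h1 : Tendsto (fun n : ℕ => t₀ - 1 / ((n : ℝ) + 1)) atTop (𝓝 t₀) := by
      have h : Tendsto (fun n : ℕ => 1 / ((n : ℝ) + 1)) atTop (𝓝 0) :=
        tendsto_one_div_add_atTop_nhds_zero_nat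
      have h2 := h.const_sub t₀
      rwa [sub_zero] at h2
    exact tendsto_of_tendsto_of_tendsto_of_le_of_le h1 tendsto_const_nhds
      (fun n => (htn n).2.1.le) (fun n => (htn n).1.2.le)
  -- ## integrability of the pairings at good times and the additivity of the limit
  have hball_fin : IsFiniteMeasure (volume.restrict (ball x₀ R)) :=
    isFiniteMeasure_restrict.2 measure_ball_lt_top.ne
  have hu1 : ∀ n, Integrable (u (tn n)) (volume.restrict (ball x₀ R)) := by
    intro n
    have hmeas := (htn n).2.2
    have hsq := MemWeakLp.setLIntegral_enorm_sq_le_of_three hmeas univ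
    rw [Measure.restrict_univ] at hsq
    have hfin : ∫⁻ x, ‖u (tn n) x‖ₑ ^ 2 ∂(volume.restrict (ball x₀ R)) < ⊤ := by
      refine lt_of_le_of_lt hsq (ENNReal.add_lt_top.2 ⟨?_, ENNReal.mul_lt_top (by norm_num)
        ((hweak _ (htn n).1).trans_lt hW.lt_top)⟩)
      rw [Measure.restrict_apply_univ]; exact measure_ball_lt_top
    have h2 : MemLp (u (tn n)) 2 (volume.restrict (ball x₀ R)) := by
      refine ⟨hmeas, ?_⟩
      rw [eLpNorm_eq_lintegral_rpow_enorm_toReal two_ne_zero ENNReal.ofNat_ne_top, ENNReal.toReal_ofNat]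
      refine ENNReal.rpow_lt_top_of_nonneg (by norm_num) (lt_top_iff_ne_top.1 ?_)
      refine lt_of_le_of_lt (le_of_eq (lintegral_congr fun x => ?_)) hfin
      rw [← ENNReal.rpow_natCast]; norm_num
    exact h2.integrable one_le_two
  -- pairings with fields supported in the ball are integrals over the ball
  have hpair : ∀ (v g : EuclideanSpace ℝ (Fin 3) → EuclideanSpace ℝ (Fin 3)),
      support g ⊆ ball x₀ R → ∫ x, ⟪v x, g x⟫ = ∫ x in ball x₀ R, ⟪v x, g x⟫ := by
    intro v g hg
    refine (setIntegral_eq_integral_of_forall_compl_eq_zero fun x hx => ?_).symm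
    rw [notMem_support.1 (fun h => hx (hg h)), inner_zero_right]
  have hint : ∀ n (g : EuclideanSpace ℝ (Fin 3) → EuclideanSpace ℝ (Fin 3)),
      AEStronglyMeasurable g volume → (∀ x, ‖g x‖ ≤ Θ₀) →
      Integrable (fun x => ⟪u (tn n) x, g x⟫) (volume.restrict (ball x₀ R)) := by
    intro n g hgm hgb
    refine ((hu1 n).norm.mul_const Θ₀).mono' ((htn n).2.2.inner hgm.restrict) ?_
    refine Eventually.of_forall fun x => ?_
    calc ‖⟪u (tn n) x, g x⟫‖ ≤ ‖u (tn n) x‖ * ‖g x‖ := norm_inner_le_norm _ _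
      _ ≤ ‖u (tn n) x‖ * Θ₀ := by gcongr; exact hgb x
  have hadd : ∫ x, ⟪u t₀ x, θ x⟫ = (∫ x, ⟪u t₀ x, θE x⟫) + ∫ x, ⟪u t₀ x, θc x⟫ := by
    have h1 : Tendsto (fun n => ∫ x, ⟪u (tn n) x, θ x⟫) atTop (𝓝 (∫ x, ⟪u t₀ x, θ x⟫)) :=
      hL.comp htn_lim
    have h2 : Tendsto (fun n => (∫ x, ⟪u (tn n) x, θE x⟫) + ∫ x, ⟪u (tn n) x, θc x⟫) atTop
        (𝓝 ((∫ x, ⟪u t₀ x, θE x⟫) + ∫ x, ⟪u t₀ x, θc x⟫)) :=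
      (hLE.comp htn_lim).add (hLc.comp htn_lim)
    refine tendsto_nhds_unique (h1.congr fun n => ?_) h2
    show ∫ x, ⟪u (tn n) x, θ x⟫ = (∫ x, ⟪u (tn n) x, θE x⟫) + ∫ x, ⟪u (tn n) x, θc x⟫
    rw [hpair _ _ (hθs.trans hϱR), hpair _ _ (hθEs.trans hϱR), hpair _ _ (hθcs.trans hϱR),
      ← integral_add (hint n θE hθEm hθEb) (hint n θc hθcm hθcb)]
    refine integral_congr_ae (Eventually.of_forall fun x => ?_)
    show ⟪u (tn n) x, θ x⟫ = ⟪u (tn n) x, θE x⟫ + ⟪u (tn n) x, θc x⟫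
    rw [← inner_add_right, ← Pi.add_apply, ← hsplit]
  -- ## the `E`-part: `L^{3,∞} ⊂ L¹_loc` quantitatively, uniformly along the good times
  have hEpart : |∫ x, ⟪u t₀ x, θE x⟫| ≤ Θ₀ * (m * lam + 1 / 2 * lam⁻¹ ^ 2 * W.toReal) := by
    have hb : ∀ n, |∫ x, ⟪u (tn n) x, θE x⟫| ≤ Θ₀ * (m * lam + 1 / 2 * lam⁻¹ ^ 2 * W.toReal) := by
      intro n
      have hmeas := (htn n).2.2
      -- `∫_E |u(tₙ)| ≤ |E| λ + ½ λ⁻² W`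
      have hkey := MemWeakLp.setLIntegral_rpow_le (p := 3) (μ := volume.restrict (ball x₀ R)) hmeas
        (r := 1) one_pos (by rw [ENNReal.toReal_ofNat]; norm_num) E hlam
      rw [ENNReal.toReal_ofNat, Real.rpow_one, Measure.restrict_restrict hEm,
        inter_eq_left.2 (hEball.trans hϱR), Measure.restrict_apply' measurableSet_ball,
        inter_eq_left.2 (hEball.trans hϱR)] at hkey
      have e1 : (1 : ℝ) / (3 - 1) * lam ^ ((1 : ℝ) - 3) = 1 / 2 * lam⁻¹ ^ 2 := by
        rw [show ((1 : ℝ) - 3) = -2 by norm_num, Real.rpow_neg hlam.le, inv_pow]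
        norm_num
      rw [e1] at hkey
      have hlin : ∫⁻ x in E, ‖u (tn n) x‖ₑ ≤
          ENNReal.ofReal m * ENNReal.ofReal lam + ENNReal.ofReal (1 / 2 * lam⁻¹ ^ 2) * W := by
        calc ∫⁻ x in E, ‖u (tn n) x‖ₑ = ∫⁻ x in E, ‖u (tn n) x‖ₑ ^ (1 : ℝ) := by simp
          _ ≤ volume E * ENNReal.ofReal lam +
              ENNReal.ofReal (1 / 2 * lam⁻¹ ^ 2) * eWeakLpPow (u (tn n)) 3 (volume.restrict (ball x₀ R)) := hkey
          _ ≤ ENNReal.ofReal m * ENNReal.ofReal lam + ENNReal.ofReal (1 / 2 * lam⁻¹ ^ 2) * W := by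
              gcongr; exact hweak _ (htn n).1
      have hfinI : ∫⁻ x in E, ‖u (tn n) x‖ₑ ≠ ⊤ :=
        ne_top_of_le_ne_top (ENNReal.add_ne_top.2 ⟨ENNReal.mul_ne_top ENNReal.ofReal_ne_top
          ENNReal.ofReal_ne_top, ENNReal.mul_ne_top ENNReal.ofReal_ne_top hW⟩) hlin
      have hreal : (∫⁻ x in E, ‖u (tn n) x‖ₑ).toReal ≤ m * lam + 1 / 2 * lam⁻¹ ^ 2 * W.toReal := by
        have h := ENNReal.toReal_mono (ENNReal.add_ne_top.2 ⟨ENNReal.mul_ne_top ENNReal.ofReal_ne_top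
          ENNReal.ofReal_ne_top, ENNReal.mul_ne_top ENNReal.ofReal_ne_top hW⟩) hlin
        rwa [ENNReal.toReal_add (ENNReal.mul_ne_top ENNReal.ofReal_ne_top ENNReal.ofReal_ne_top)
          (ENNReal.mul_ne_top ENNReal.ofReal_ne_top hW), ENNReal.toReal_mul, ENNReal.toReal_mul,
          ENNReal.toReal_ofReal hm, ENNReal.toReal_ofReal hlam.le,
          ENNReal.toReal_ofReal (by positivity)] at h
      -- the pairing is bounded by `Θ₀ ∫_E |u(tₙ)|`
      have hI : Integrable (E.indicator (u (tn n))) volume := by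
        rw [integrable_indicator_iff hEm]
        exact (hu1 n).mono_measure (Measure.restrict_mono (hEball.trans hϱR) le_rfl)
      have hpt : ∀ x, ‖⟪u (tn n) x, θE x⟫‖ ≤ Θ₀ * ‖E.indicator (u (tn n)) x‖ := by
        intro x
        by_cases hx : x ∈ E
        · rw [hθE, indicator_of_mem hx, indicator_of_mem hx]
          calc ‖⟪u (tn n) x, θ x⟫‖ ≤ ‖u (tn n) x‖ * ‖θ x‖ := norm_inner_le_norm _ _
            _ ≤ ‖u (tn n) x‖ * Θ₀ := by gcongr; exact hθb x
            _ = Θ₀ * ‖u (tn n) x‖ := mul_comm _ _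
        · rw [hθE, indicator_of_notMem hx, indicator_of_notMem hx, inner_zero_right, norm_zero,
            norm_zero, mul_zero]
      have h1 := norm_integral_le_of_norm_le (hI.norm.const_mul Θ₀) (Eventually.of_forall hpt)
      rw [Real.norm_eq_abs, integral_const_mul] at h1
      refine h1.trans (mul_le_mul_of_nonneg_left ?_ hΘ₀)
      -- `∫ ‖1_E u(tₙ)‖ = (∫⁻_E ‖u(tₙ)‖ₑ).toReal`
      have e2 : ∫ x, ‖E.indicator (u (tn n)) x‖ = (∫⁻ x in E, ‖u (tn n) x‖ₑ).toReal := by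
        rw [integral_norm_eq_lintegral_enorm hI.aestronglyMeasurable]
        congr 1
        rw [← lintegral_indicator hEm]
        refine lintegral_congr fun x => ?_
        by_cases hx : x ∈ E
        · rw [indicator_of_mem hx, indicator_of_mem hx]
        · rw [indicator_of_notMem hx, indicator_of_notMem hx, enorm_zero]
      rw [e2]
      exact hreal
    exact le_of_tendsto ((hLE.comp htn_lim).abs) (Eventually.of_forall hb)
  -- ## the complementary part: `|u(t₀)| ≤ τ` off `E` inside the ball
  have hcpart : |∫ x, ⟪u t₀ x, θc x⟫| ≤ τ * ∫ x, ‖θ x‖ := by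
    have hθi : Integrable θ volume := integrable_of_bound_of_support hθm hθb hθs
    have hpt : ∀ x, ‖⟪u t₀ x, θc x⟫‖ ≤ τ * ‖θ x‖ := by
      intro x
      by_cases hxE : x ∈ E
      · rw [hθc, indicator_of_notMem (Set.notMem_compl_iff.2 hxE), inner_zero_right, norm_zero]
        positivity
      · rw [hθc, indicator_of_mem (mem_compl hxE)]
        by_cases hxθ : x ∈ support θ
        · have hxb : x ∈ ball x₀ ϱ := hθs hxθ
          have hxu : ‖u t₀ x‖ ≤ τ := by
            by_contra hlt
            exact hxE (hE₀E ⟨not_le.1 hlt, hxb⟩)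
          calc ‖⟪u t₀ x, θ x⟫‖ ≤ ‖u t₀ x‖ * ‖θ x‖ := norm_inner_le_norm _ _
            _ ≤ τ * ‖θ x‖ := by gcongr
        · rw [notMem_support.1 hxθ, inner_zero_right, norm_zero, norm_zero, mul_zero]
    have h1 := norm_integral_le_of_norm_le (hθi.norm.const_mul τ) (Eventually.of_forall hpt)
    rwa [Real.norm_eq_abs, integral_const_mul] at h1
  -- ## conclusion
  rw [hadd]
  exact (abs_add_le _ _).trans (add_le_add hEpart hcpart)

end Seregin2019

end Literature.Analysis.FluidPDE

end
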